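/-
Copyright: the b2b-balaban T⁴-continuum CRUX team, row NE7b leaf lineage `t4-ne7b-formalise-leaf-06` (gen 162). Project licence.
-/
import Mathlib.Analysis.Seminorm
import Summits.QuantumFields.BalabanUV.T4Continuum.Spine.NE7b.SupInductiveStep

/-!
# SIS's BRANCH IN A SECOND CURRENCY, OFF THE ORIGIN: one bootstrap inequality for BOTH columns of the interacting chart's
# inverse — if the chart inverse is bounded between seminorms, `p_E(T⁻¹(y₁, y₂)) ≤ N^w(p_F y₁ + p_K y₂)`, and the fibre-projected
# linearisation defect is `p_K(P((A − X)u)) ≤ c^w p_E(u)` with `N^w c^w < 1`, then EVERY `u` obeys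
# `p_E(u) ≤ N^w(1 − N^w c^w)⁻¹ (p_F(Q u) + p_K(P(X u)))`; at `X = Eq′(σ w)` this is the response letter (`Q u = v`, `P(X u) = 0`),
# the fibre ∕ covariance letter (`Q u = 0`, `P(X u) = κ`), the response's two-point modulus, and the NEXT equation map's
# second-currency bound and modulus — the weighted twin of `…SupInductiveStep` (c)
# (row NE7b, node U5c; SIS BY NAME; [folklore]; any Banach currencies, any seminorms)

Cell `pub-balaban`, sub-cell `t4`, spine estimate NE7b (`T4WeightBudget.RelWeightBound`; the cell's OWN estimate — NOT PRINTED in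
[Bałaban 1983–89], NOT PROVED).  Crux-route work under `Spine/NE7b/` by a row leaf (`t4-ne7b-formalise-leaf-06` gen 162) under FREEZE
(0)'s crux-prover clause, on the row OWNER's word (W-ne7bp1-g116-1 (b): «GO — WANTED: the abstract skeleton of (63) `weighted_apriori`;
the owner does not pre-empt it (the ℓ^∞ instance stays (63))»; the OWNER g115's answer to this lineage's ι-3: «the per-level letters in
SET's currency are the natural next owner∕leaf junction after (65) — whoever takes it says so in one line» — taken, journal
[NE7bLEAF06-G162-ONLINE]).  NOTHING of Bałaban's is named as a Lean object, valued or asserted; no `T4Continuum/Support` leaf typed;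
no `def`; zero `sorry`.  Imports: `Mathlib.Analysis.Seminorm` (the second currency) and this lineage's `…SupInductiveStep` (SIS).

WHY (located).  `…SupEquationTowerSections` (SECS) settled the second currency AT THE ORIGIN: there the branch response IS the chart's
section, `Dσ_k(0) = T_k⁻¹∘inl`, and any seminorm letter of the charts' sections multiplies along the tower — no smallness.  OFF the
origin the linearisation moves: `Dσ(w) = A(w)⁻¹∘inl` for the chart `A(w) = (Q, P∘Eq′(σ w))` at the background, not for `T = (Q, P∘A)`.
The OWNER's (63) `…SupBackgroundLocalisation.weighted_apriori` handles this in the `ℓ^∞(ℤ^d)` model by an a-priori bootstrap: a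
solution `u` of the linearised system at the background solves the FREE chart's system with the defect as an extra source,
`u = T⁻¹(Q u, P(X u) + P((A − X)u))`, and the defect is small in the weighted norm, so `(1 − N^w c^w) p_E(u) ≤ N^w(p_F(Q u) + p_K(P(X u)))`.
THIS FILE is that bootstrap with the model stripped: three seminorms `p_E, p_F, p_K` (no topology asked of them), the chart's letter
`N^w`, the defect letter `c^w`, and `N^w c^w < 1`.  ONE inequality (§1 `seminorm_le_of_chart_letters`) serves both columns of `A(w)⁻¹`:
the RESPONSE `Dσ(w) v` (`Q u = v`, `P(X u) = 0` — SIS (b)'s transversality off the origin) and the FIBRE SOLUTION ∕ covariance column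
(`Q u = 0`, `P(X u) = κ` — the OWNER's `C̃(w)κ` of (60) v1.1 ∕ (63), read here as «any `u` in `ker Q`», no equivalence needed); and,
because the difference of the responses at two backgrounds lies in `ker Q` with fibre source `P((Eq′(σ w′) − Eq′(σ w))(Dσ(w′) v))`,
the same inequality gives the response's second-currency two-point modulus from a second-currency modulus of `Eq′` with the
background displacement measured in the FIRST currency (`p_E((Eq′ x − Eq′ x′)u) ≤ M^w‖x − x′‖p_E(u)` — the shape of (64) §4 ∕ (65) §4,
where the Nemytskii derivative is diagonal).  With seminorm letters for `Q` and `P` the NEXT equation map `Q∘Eq∘σ` then carries a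
second-currency bound `C^w_Q B^w K^w` and modulus `C^w_Q M^w K₁ K^w (1 + B^w C^w_P K^w)` (`K^w := N^w(1 − N^w c^w)⁻¹`, `K₁ := (N⁻¹ − c)⁻¹`)
— the same shape as SIS (c)'s `‖Q‖ M K₁²(1 + B C_P K₁)` with one `K₁` per factor replaced by `K^w`: the «`B^w_{k+1}`» slot this lineage
located at X-OWNER65 (ι-2; its `ℓ^∞` instance is (65) `weighted_nextScale_of_letters`), i.e. the second-currency state RE-ENTERS.
HONEST BOOKKEEPING: nothing is small by itself — `K^w ≥ N^w`, and the next letters are DISPLAYED products; their control in the model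
is the OWNER's one-shot ∕ semigroup identification (SOS `tower_eq_oneShot`; C-ne7bp1-g116-2 `SupBackgroundSemigroup`), not typed here.

WHAT IS PROVED ([folklore]; `E F K` real normed spaces, `p_E, p_F, p_K` seminorms; §3 needs `E` complete and nontrivial for SIS):
* §1 `apply_eq_add_sub_apply` (`A u = X u + (A − X)u`), **`seminorm_le_of_chart_letters`** (THE BOOTSTRAP: `T h = (Q h, P(A h))`,
  `p_E(T⁻¹(y₁,y₂)) ≤ N^w(p_F y₁ + p_K y₂)`, `p_K(P((A − X)u)) ≤ c^w p_E u`, `0 ≤ N^w`, `N^w c^w < 1` ⊢ for ALL `u`: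
  `p_E u ≤ N^w∕(1 − N^w c^w)·(p_F(Q u) + p_K(P(X u)))`), `seminorm_section_le` (the response column: `Q∘D = 1`, `P(X(D v)) = 0` ⊢
  `p_E(D v) ≤ K^w p_F v`), `seminorm_fibre_le` (the fibre column: `Q u = 0` ⊢ `p_E u ≤ K^w p_K(P(X u))`), `seminorm_section_sub_le`
  (two sections `D, D′` transversal for `X, X′`: `p_E((D − D′)v) ≤ K^w p_K(P((X′ − X)(D′ v)))`).
* §2 `Kw_nonneg`, `seminorm_section_sub_le_of_modulus` (§1's difference letter fed with `p_K∘P ≤ C^w_P p_E`, the `Eq′`-modulus and the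
  branch's Lipschitz letter: `p_E((D − D′)v) ≤ K^w·C^w_P·M^w·‖x − x′‖·K′^w·p_F v`).
* §3 **`inductiveStep_eq_secondCurrency`** — `…SupInductiveStep.inductiveStep_eq`'s hypotheses VERBATIM ⟹ `∃ σ` with SIS's
  conclusions (a) (b) (c) (d) RE-EXPORTED AND — quantified AFTER `σ`, so ONE `σ` serves EVERY admissible weight (the OWNER's rider (i) on
  SECS: the content of (62)–(66) is UNIFORMITY over the weights) — for every second currency (`p_E, p_F, p_K`; `0 ≤ N^w, B^w, M^w, C^w_P,
  C^w_Q`; chart letter; `Eq′` bound `p_E(Eq′ x u) ≤ B^w p_E u` and modulus `p_E((Eq′ x − Eq′ x′)u) ≤ M^w‖x − x′‖p_E u` on `closedBall 0 r`;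
  `p_K(P h) ≤ C^w_P p_E h`, `p_F(Q h) ≤ C^w_Q p_E h`; defect `p_K(P((A − Eq′ x)u)) ≤ c^w p_E u` on `closedBall 0 r`; `N^w c^w < 1`), with
  `K^w := N^w∕(1 − N^w c^w)`, `K₁ := (N⁻¹ − c)⁻¹`: (W1) on `closedBall 0 ρ` the fibre letter at the background
  `Q u = 0 → p_E u ≤ K^w p_K(P(Eq′(σ w) u))`; (W2) on `ball 0 ρ` the response letter `p_E(Dσ(w) v) ≤ K^w p_F v`; (W3) the response's
  two-point modulus `p_E((Dσ w − Dσ w′) v) ≤ K^w C^w_P M^w K₁ K^w ‖w − w′‖ p_F v`; (W4) the next equation map's derivative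
  `p_F(Q(Eq′(σ w)(Dσ(w) v))) ≤ C^w_Q B^w K^w p_F v`; (W5) its modulus
  `p_F(Q(Eq′(σ w)(Dσ(w) v)) − Q(Eq′(σ w′)(Dσ(w′) v))) ≤ C^w_Q (M^w K₁ K^w + B^w (K^w C^w_P M^w K₁ K^w)) ‖w − w′‖ p_F v`.
* §4 toy (`example`): the bootstrap arithmetic.

NOT HERE (honest): the re-entrant STEP ∕ TOWER carrying this state over ℕ (siblings, next); the `ℓ^∞(ℤ^d)` instance (the OWNER's
(62)–(66): `p` = weighted sup norms `‖·‖_{μ,ρ}`, `N^w` = (62) `weighted_augInverse`, `c^w = C_P λ`, `M^w = L`, `C^w_Q = 1`); any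
control of `K^w` or of the products; (A3) ∕ (A1c); NC-NE7b-α UNRULED; anything of Bałaban's.  BY-NAME EFFECT ON THE WALL: NONE.
NE7b NOT PRINTED ∕ NOT PROVED; spine PROVED 0∕9; rung (B)+1 on a FINITE torus — NOT infinite volume, NOT the mass gap, NOT Clay.
HONEST DEPENDENCY: continuum YM on T⁴ ⇐ BetaPertH ∧ nine spine estimates (0∕9 proved); BetaPertH ⇐ (D1) ∧ (D4) ∧ CAP+tail;
G-an2-4 gates asym, D1 and NE2∕3∕4.
-/

set_option autoImplicit false

noncomputable section

namespace Summit.QuantumFields.BalabanUV.T4Continuum.NE7b.SupResponseSecondCurrency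

open Set Metric Function
open scoped NNReal
open Summit.QuantumFields.BalabanUV.T4Continuum.NE7b

variable {E F K : Type*} [NormedAddCommGroup E] [NormedSpace ℝ E] [NormedAddCommGroup F] [NormedSpace ℝ F]
  [NormedAddCommGroup K] [NormedSpace ℝ K]

/-! ## §1. The bootstrap: one inequality for both columns of the chart inverse at a moved linearisation -/

/-- Bookkeeping: `A u = X u + (A − X) u`. [folklore] -/
theorem apply_eq_add_sub_apply (A X : E →L[ℝ] E) (u : E) : A u = X u + (A - X) u := by
  rw [sub_apply]; abel

/-- **THE SECOND-CURRENCY BOOTSTRAP.**  Chart `T h = (Q h, P(A h))` with inverse bounded between seminorms,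
`p_E(T⁻¹(y₁, y₂)) ≤ N^w(p_F y₁ + p_K y₂)`, `0 ≤ N^w`; a moved linear part `X` with fibre-projected defect `p_K(P((A − X)u)) ≤ c^w p_E u`;
`N^w c^w < 1`.  Then EVERY `u` obeys `p_E u ≤ N^w∕(1 − N^w c^w)·(p_F(Q u) + p_K(P(X u)))` — `u` solves the chart's system with its own
defect as an extra fibre source. [folklore] -/
theorem seminorm_le_of_chart_letters (Q : E →L[ℝ] F) (P : E →L[ℝ] K) (A X : E →L[ℝ] E) (T : E ≃L[ℝ] F × K)
    (hT : ∀ h, T h = (Q h, P (A h))) (pE : Seminorm ℝ E) (pF : Seminorm ℝ F) (pK : Seminorm ℝ K) {Nw cw : ℝ}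
    (hNw : 0 ≤ Nw) (hTw : ∀ y₁ y₂, pE (T.symm (y₁, y₂)) ≤ Nw * (pF y₁ + pK y₂))
    (hcw : ∀ u, pK (P ((A - X) u)) ≤ cw * pE u) (hsmall : Nw * cw < 1) (u : E) :
    pE u ≤ Nw / (1 - Nw * cw) * (pF (Q u) + pK (P (X u))) := by
  have hpos : 0 < 1 - Nw * cw := sub_pos.2 hsmall
  -- `u = T⁻¹(Q u, P(A u))` and `P(A u) = P(X u) + P((A − X) u)`
  have hu : u = T.symm (Q u, P (X u) + P ((A - X) u)) := by
    have e : T u = (Q u, P (X u) + P ((A - X) u)) := by rw [hT, apply_eq_add_sub_apply A X u, map_add]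
    rw [← e, ContinuousLinearEquiv.symm_apply_apply]
  have h1 : pE u ≤ Nw * (pF (Q u) + (pK (P (X u)) + cw * pE u)) := by
    have h := hTw (Q u) (P (X u) + P ((A - X) u))
    rw [← hu] at h
    refine h.trans (mul_le_mul_of_nonneg_left (add_le_add le_rfl ?_) hNw)
    exact (map_add_le_add pK _ _).trans (add_le_add le_rfl (hcw u))
  have h2 : (1 - Nw * cw) * pE u ≤ Nw * (pF (Q u) + pK (P (X u))) := by nlinarith
  rw [div_mul_eq_mul_div, le_div_iff₀ hpos, mul_comm]
  exact h2

/-- **THE RESPONSE COLUMN.**  A section `D` of `Q` transversal for `P∘X` (`P(X(D v)) = 0`) obeys `p_E(D v) ≤ N^w∕(1 − N^w c^w)·p_F v`.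
[folklore] -/
theorem seminorm_section_le (Q : E →L[ℝ] F) (P : E →L[ℝ] K) (A X : E →L[ℝ] E) (T : E ≃L[ℝ] F × K)
    (hT : ∀ h, T h = (Q h, P (A h))) (pE : Seminorm ℝ E) (pF : Seminorm ℝ F) (pK : Seminorm ℝ K) {Nw cw : ℝ}
    (hNw : 0 ≤ Nw) (hTw : ∀ y₁ y₂, pE (T.symm (y₁, y₂)) ≤ Nw * (pF y₁ + pK y₂))
    (hcw : ∀ u, pK (P ((A - X) u)) ≤ cw * pE u) (hsmall : Nw * cw < 1)
    {D : F →L[ℝ] E} (hQD : Q.comp D = ContinuousLinearMap.id ℝ F) (hPD : ∀ v, P (X (D v)) = 0) (v : F) :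
    pE (D v) ≤ Nw / (1 - Nw * cw) * pF v := by
  have h := seminorm_le_of_chart_letters Q P A X T hT pE pF pK hNw hTw hcw hsmall (D v)
  have hQ : Q (D v) = v := by simpa using congrArg (fun L : F →L[ℝ] F => L v) hQD
  rwa [hQ, hPD, map_zero, add_zero] at h

/-- **THE FIBRE (COVARIANCE) COLUMN.**  Any `u` with `Q u = 0` obeys `p_E u ≤ N^w∕(1 − N^w c^w)·p_K(P(X u))` — the fibre solution of the
moved linearised system is bounded in the second currency by its fibre source. [folklore] -/
theorem seminorm_fibre_le (Q : E →L[ℝ] F) (P : E →L[ℝ] K) (A X : E →L[ℝ] E) (T : E ≃L[ℝ] F × K)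
    (hT : ∀ h, T h = (Q h, P (A h))) (pE : Seminorm ℝ E) (pF : Seminorm ℝ F) (pK : Seminorm ℝ K) {Nw cw : ℝ}
    (hNw : 0 ≤ Nw) (hTw : ∀ y₁ y₂, pE (T.symm (y₁, y₂)) ≤ Nw * (pF y₁ + pK y₂))
    (hcw : ∀ u, pK (P ((A - X) u)) ≤ cw * pE u) (hsmall : Nw * cw < 1) {u : E} (hQu : Q u = 0) :
    pE u ≤ Nw / (1 - Nw * cw) * pK (P (X u)) := by
  have h := seminorm_le_of_chart_letters Q P A X T hT pE pF pK hNw hTw hcw hsmall u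
  rwa [hQu, map_zero, zero_add] at h

/-- **THE DIFFERENCE OF TWO RESPONSES LIES IN THE FIBRE.**  Sections `D, D′` of `Q` transversal for `P∘X`, `P∘X′` respectively: the
difference `(D − D′)v` has `Q`-image `0` and `X`-fibre source `P((X′ − X)(D′ v))`, so `p_E((D − D′)v) ≤ N^w∕(1 − N^w c^w)·p_K(P((X′ − X)(D′ v)))`
(defect letter for `X`). [folklore] -/
theorem seminorm_section_sub_le (Q : E →L[ℝ] F) (P : E →L[ℝ] K) (A X X' : E →L[ℝ] E) (T : E ≃L[ℝ] F × K)
    (hT : ∀ h, T h = (Q h, P (A h))) (pE : Seminorm ℝ E) (pF : Seminorm ℝ F) (pK : Seminorm ℝ K) {Nw cw : ℝ}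
    (hNw : 0 ≤ Nw) (hTw : ∀ y₁ y₂, pE (T.symm (y₁, y₂)) ≤ Nw * (pF y₁ + pK y₂))
    (hcw : ∀ u, pK (P ((A - X) u)) ≤ cw * pE u) (hsmall : Nw * cw < 1)
    {D D' : F →L[ℝ] E} (hQD : Q.comp D = ContinuousLinearMap.id ℝ F) (hQD' : Q.comp D' = ContinuousLinearMap.id ℝ F)
    (hPD : ∀ v, P (X (D v)) = 0) (hPD' : ∀ v, P (X' (D' v)) = 0) (v : F) :
    pE ((D - D') v) ≤ Nw / (1 - Nw * cw) * pK (P ((X' - X) (D' v))) := by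
  have hQ : Q ((D - D') v) = 0 := by
    have e1 : Q (D v) = v := by simpa using congrArg (fun L : F →L[ℝ] F => L v) hQD
    have e2 : Q (D' v) = v := by simpa using congrArg (fun L : F →L[ℝ] F => L v) hQD'
    rw [sub_apply, map_sub, e1, e2, sub_self]
  have h := seminorm_fibre_le Q P A X T hT pE pF pK hNw hTw hcw hsmall hQ
  -- the fibre source: `P(X((D − D′)v)) = P(X(Dv)) − P(X(D′v)) = −P(X(D′v)) = P(X′(D′v)) − P(X(D′v))`
  have e : P (X ((D - D') v)) = P ((X' - X) (D' v)) := by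
    rw [sub_apply, map_sub, map_sub, hPD, zero_sub, sub_apply, map_sub, hPD', zero_sub]
  rwa [e] at h

/-! ## §2. The difference letter fed with a modulus -/

/-- `0 ≤ N^w` and `N^w c^w < 1` give `0 ≤ N^w∕(1 − N^w c^w)`. [folklore] -/
theorem Kw_nonneg {Nw cw : ℝ} (hNw : 0 ≤ Nw) (hsmall : Nw * cw < 1) : 0 ≤ Nw / (1 - Nw * cw) :=
  div_nonneg hNw (sub_pos.2 hsmall).le

/-- **THE RESPONSE's TWO-POINT LETTER, ABSTRACTLY.**  §1's difference letter with: `p_K(P h) ≤ C^w_P p_E h`; a second-currency modulus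
of the linearisation with FIRST-currency displacement, `p_E((X′ − X)u) ≤ M^w·δ·p_E u` (`δ` the displacement size, `0 ≤ M^w δ`); and the
other response's letter `p_E(D′ v) ≤ K′ p_F v` (`0 ≤ K′`) ⊢ `p_E((D − D′)v) ≤ N^w∕(1 − N^w c^w)·C^w_P·(M^w δ)·K′·p_F v`. [folklore] -/
theorem seminorm_section_sub_le_of_modulus (Q : E →L[ℝ] F) (P : E →L[ℝ] K) (A X X' : E →L[ℝ] E) (T : E ≃L[ℝ] F × K)
    (hT : ∀ h, T h = (Q h, P (A h))) (pE : Seminorm ℝ E) (pF : Seminorm ℝ F) (pK : Seminorm ℝ K) {Nw cw : ℝ}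
    (hNw : 0 ≤ Nw) (hTw : ∀ y₁ y₂, pE (T.symm (y₁, y₂)) ≤ Nw * (pF y₁ + pK y₂))
    (hcw : ∀ u, pK (P ((A - X) u)) ≤ cw * pE u) (hsmall : Nw * cw < 1)
    {D D' : F →L[ℝ] E} (hQD : Q.comp D = ContinuousLinearMap.id ℝ F) (hQD' : Q.comp D' = ContinuousLinearMap.id ℝ F)
    (hPD : ∀ v, P (X (D v)) = 0) (hPD' : ∀ v, P (X' (D' v)) = 0)
    {CPw Mδ K' : ℝ} (hCPw0 : 0 ≤ CPw) (hMδ0 : 0 ≤ Mδ) (hCPw : ∀ h, pK (P h) ≤ CPw * pE h)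
    (hX : ∀ u, pE ((X' - X) u) ≤ Mδ * pE u) (hD' : ∀ v, pE (D' v) ≤ K' * pF v) (v : F) :
    pE ((D - D') v) ≤ Nw / (1 - Nw * cw) * (CPw * (Mδ * (K' * pF v))) := by
  have hK := Kw_nonneg hNw hsmall
  refine (seminorm_section_sub_le Q P A X X' T hT pE pF pK hNw hTw hcw hsmall hQD hQD' hPD hPD' v).trans
    (mul_le_mul_of_nonneg_left ?_ hK)
  refine (hCPw _).trans (mul_le_mul_of_nonneg_left ?_ hCPw0)
  exact (hX _).trans (mul_le_mul_of_nonneg_left (hD' v) hMδ0)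

/-! ## §3. ON SIS's BRANCH: the second-currency letters off the origin, and the next equation map in the second currency -/

/-- **SIS's INDUCTIVE STEP WITH A SECOND CURRENCY.**  `…SupInductiveStep.inductiveStep_eq`'s hypotheses verbatim.  Conclusions: SIS's
(a) (b) (c) (d) for one `σ`, AND for that `σ` — quantified AFTER it, one `σ` for all admissible weights — for every choice of seminorms
`p_E, p_F, p_K`, nonnegative constants `N^w, B^w, M^w, C^w_P, C^w_Q`, the chart's seminorm letter `p_E(T⁻¹(y₁,y₂)) ≤ N^w(p_F y₁ + p_K y₂)`,
the linearisation's second-currency bound `p_E(Eq′ x u) ≤ B^w p_E u` and modulus `p_E((Eq′ x − Eq′ x′)u) ≤ M^w‖x − x′‖p_E u` on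
`closedBall 0 r` (displacement in the FIRST currency), `p_K(P h) ≤ C^w_P p_E h`, `p_F(Q h) ≤ C^w_Q p_E h`, the fibre-projected defect
`p_K(P((A − Eq′ x)u)) ≤ c^w p_E u` on `closedBall 0 r` and `N^w c^w < 1`: with `K^w = N^w∕(1 − N^w c^w)`, `K₁ = (N⁻¹ − c)⁻¹`,
`ρ = (N⁻¹ − c)r` — (W1) the fibre letter at every background in the closed chart ball, (W2) the response letter, (W3) the response's
two-point modulus, (W4)∕(W5) the next equation map's second-currency bound and modulus on the open chart ball. [folklore] -/
theorem inductiveStep_eq_secondCurrency [CompleteSpace E] [Nontrivial E]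
    (Q : E →L[ℝ] F) (Lp : F →L[ℝ] E) (P : E →L[ℝ] K) (ι : K →L[ℝ] E)
    (hPι : ∀ h, ι (P h) = h - Lp (Q h)) {CP : ℝ} (hCP : ‖P‖ ≤ CP)
    {Eq : E → E} {Eq' : E → E →L[ℝ] E} (hE0 : Eq 0 = 0) {r : ℝ} (hr : 0 ≤ r)
    (hE : ∀ x ∈ closedBall (0 : E) r, HasFDerivAt Eq (Eq' x) x)
    {B M₃ : ℝ} (hB : ∀ x ∈ closedBall (0 : E) r, ‖Eq' x‖ ≤ B) (hM₃ : 0 ≤ M₃)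
    (hM : ∀ x ∈ closedBall (0 : E) r, ∀ x' ∈ closedBall (0 : E) r, ‖Eq' x - Eq' x'‖ ≤ M₃ * ‖x - x'‖)
    (A : E →L[ℝ] E) (T : E ≃L[ℝ] F × K) (hT : ∀ h, T h = (Q h, P (A h))) {N c : ℝ≥0}
    (hN : ∀ y : F × K, ‖T.symm y‖ ≤ N * ‖y‖) (hcN : c < N⁻¹)
    (hc : ∀ x ∈ closedBall (0 : E) r, ‖P.comp (Eq' x - A)‖ ≤ c) :
    ∃ σ : F → E, σ 0 = 0 ∧
      -- (a) the branch on the closed chart ball, the lift identity, Lipschitz, uniqueness (SIS, re-exported)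
      (∀ w ∈ closedBall (0 : F) (((N : ℝ)⁻¹ - c) * r),
        σ w ∈ closedBall (0 : E) r ∧ Q (σ w) = w ∧ P (Eq (σ w)) = 0 ∧ Eq (σ w) = Lp (Q (Eq (σ w)))) ∧
      LipschitzOnWith (N⁻¹ - c)⁻¹ σ (closedBall (0 : F) (((N : ℝ)⁻¹ - c) * r)) ∧
      (∀ x ∈ closedBall (0 : E) r, P (Eq x) = 0 → σ (Q x) = x) ∧
      -- (b) the derivative letters on the open chart ball (SIS, re-exported)
      (∀ w ∈ ball (0 : F) (((N : ℝ)⁻¹ - c) * r), DifferentiableAt ℝ σ w ∧ ‖fderiv ℝ σ w‖ ≤ ((N : ℝ)⁻¹ - c)⁻¹ ∧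
        Q.comp (fderiv ℝ σ w) = ContinuousLinearMap.id ℝ F ∧ ∀ k, P (Eq' (σ w) (fderiv ℝ σ w k)) = 0) ∧
      (∀ w ∈ ball (0 : F) (((N : ℝ)⁻¹ - c) * r), ∀ w' ∈ ball (0 : F) (((N : ℝ)⁻¹ - c) * r),
        ‖fderiv ℝ σ w - fderiv ℝ σ w'‖ ≤ (((N : ℝ)⁻¹ - c)⁻¹) ^ 2 * (CP * M₃) * ((N : ℝ)⁻¹ - c)⁻¹ * ‖w - w'‖) ∧
      -- (c) the next equation map `Q ∘ Eq ∘ σ` and its `C¹` letters (SIS, re-exported)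
      Q (Eq (σ 0)) = 0 ∧
      (∀ w ∈ ball (0 : F) (((N : ℝ)⁻¹ - c) * r),
        HasFDerivAt (fun w => Q (Eq (σ w))) (Q.comp ((Eq' (σ w)).comp (fderiv ℝ σ w))) w ∧
        ‖Q.comp ((Eq' (σ w)).comp (fderiv ℝ σ w))‖ ≤ ‖Q‖ * B * ((N : ℝ)⁻¹ - c)⁻¹) ∧
      (∀ w ∈ ball (0 : F) (((N : ℝ)⁻¹ - c) * r), ∀ w' ∈ ball (0 : F) (((N : ℝ)⁻¹ - c) * r),
        ‖Q.comp ((Eq' (σ w)).comp (fderiv ℝ σ w)) - Q.comp ((Eq' (σ w')).comp (fderiv ℝ σ w'))‖ ≤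
          ‖Q‖ * (M₃ * ((N : ℝ)⁻¹ - c)⁻¹ * ((N : ℝ)⁻¹ - c)⁻¹ +
            B * ((((N : ℝ)⁻¹ - c)⁻¹) ^ 2 * (CP * M₃) * ((N : ℝ)⁻¹ - c)⁻¹)) * ‖w - w'‖) ∧
      -- (d) zeros of the next equation lift to zeros of `Eq` (SIS, re-exported)
      (∀ w ∈ closedBall (0 : F) (((N : ℝ)⁻¹ - c) * r), Q (Eq (σ w)) = 0 → Eq (σ w) = 0) ∧
      -- THE SECOND CURRENCY — for EVERY seminorm triple and letters chosen AFTER `σ` (one `σ` for all admissible weights):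
      -- seminorms `p_E, p_F, p_K`; `0 ≤ N^w, B^w, M^w, C^w_P, C^w_Q`; chart letter; `Eq′` bound and modulus; `P`, `Q` letters; defect;
      -- `N^w c^w < 1` ⟹ (W1) the fibre letter at the background on the closed chart ball, (W2) the response letter, (W3) its two-point
      -- modulus, (W4)∕(W5) the next equation map's second-currency bound and modulus on the open chart ball
      (∀ (pE : Seminorm ℝ E) (pF : Seminorm ℝ F) (pK : Seminorm ℝ K) (Nw cw Bw Mw CPw CQw : ℝ),
        0 ≤ Nw → 0 ≤ Bw → 0 ≤ Mw → 0 ≤ CPw → 0 ≤ CQw →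
        (∀ y₁ y₂, pE (T.symm (y₁, y₂)) ≤ Nw * (pF y₁ + pK y₂)) →
        (∀ x ∈ closedBall (0 : E) r, ∀ u, pE (Eq' x u) ≤ Bw * pE u) →
        (∀ x ∈ closedBall (0 : E) r, ∀ x' ∈ closedBall (0 : E) r, ∀ u, pE ((Eq' x - Eq' x') u) ≤ Mw * ‖x - x'‖ * pE u) →
        (∀ h, pK (P h) ≤ CPw * pE h) → (∀ h, pF (Q h) ≤ CQw * pE h) →
        (∀ x ∈ closedBall (0 : E) r, ∀ u, pK (P ((A - Eq' x) u)) ≤ cw * pE u) → Nw * cw < 1 →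
        -- (W1) THE FIBRE LETTER AT THE BACKGROUND: the fibre solution of the linearised system at `σ w` is bounded by its source
        (∀ w ∈ closedBall (0 : F) (((N : ℝ)⁻¹ - c) * r), ∀ u, Q u = 0 →
          pE u ≤ Nw / (1 - Nw * cw) * pK (P (Eq' (σ w) u))) ∧
        -- (W2) THE RESPONSE LETTER OFF THE ORIGIN
        (∀ w ∈ ball (0 : F) (((N : ℝ)⁻¹ - c) * r), ∀ v, pE (fderiv ℝ σ w v) ≤ Nw / (1 - Nw * cw) * pF v) ∧
        -- (W3) THE RESPONSE's SECOND-CURRENCY TWO-POINT MODULUS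
        (∀ w ∈ ball (0 : F) (((N : ℝ)⁻¹ - c) * r), ∀ w' ∈ ball (0 : F) (((N : ℝ)⁻¹ - c) * r), ∀ v,
          pE ((fderiv ℝ σ w - fderiv ℝ σ w') v) ≤
            Nw / (1 - Nw * cw) * CPw * Mw * ((N : ℝ)⁻¹ - c)⁻¹ * (Nw / (1 - Nw * cw)) * ‖w - w'‖ * pF v) ∧
        -- (W4) THE NEXT EQUATION MAP's DERIVATIVE IN THE SECOND CURRENCY
        (∀ w ∈ ball (0 : F) (((N : ℝ)⁻¹ - c) * r), ∀ v,
          pF (Q (Eq' (σ w) (fderiv ℝ σ w v))) ≤ CQw * Bw * (Nw / (1 - Nw * cw)) * pF v) ∧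
        -- (W5) ITS SECOND-CURRENCY MODULUS (displacement in the first currency)
        (∀ w ∈ ball (0 : F) (((N : ℝ)⁻¹ - c) * r), ∀ w' ∈ ball (0 : F) (((N : ℝ)⁻¹ - c) * r), ∀ v,
          pF (Q (Eq' (σ w) (fderiv ℝ σ w v)) - Q (Eq' (σ w') (fderiv ℝ σ w' v))) ≤
            CQw * (Mw * ((N : ℝ)⁻¹ - c)⁻¹ * (Nw / (1 - Nw * cw)) +
              Bw * (Nw / (1 - Nw * cw) * CPw * Mw * ((N : ℝ)⁻¹ - c)⁻¹ * (Nw / (1 - Nw * cw)))) * ‖w - w'‖ * pF v)) := by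
  obtain ⟨σ, hσ0, ha, hlip, huniq, hb, hΛ, hc0, hC, hcm, hd⟩ :=
    SupInductiveStep.inductiveStep_eq Q Lp P ι hPι hCP hE0 hr hE hB hM₃ hM A T hT hN hcN hc
  refine ⟨σ, hσ0, ha, hlip, huniq, hb, hΛ, hc0, hC, hcm, hd, ?_⟩
  intro pE pF pK Nw cw Bw Mw CPw CQw hNw hBw0 hMw0 hCPw0 hCQw0 hTw hBw hMw hCPw hCQw hcw hsmall
  -- constants and ball bookkeeping
  set Kw : ℝ := Nw / (1 - Nw * cw) with hKw_def
  have hKw : 0 ≤ Kw := Kw_nonneg hNw hsmall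
  have hc' : (c : ℝ) < (N : ℝ)⁻¹ := by
    have h := NNReal.coe_lt_coe.2 hcN
    rwa [NNReal.coe_inv] at h
  have hK1 : (0 : ℝ) ≤ ((N : ℝ)⁻¹ - c)⁻¹ := inv_nonneg.2 (sub_pos.2 hc').le
  have hcoe : (((N⁻¹ - c)⁻¹ : ℝ≥0) : ℝ) = ((N : ℝ)⁻¹ - c)⁻¹ := by
    rw [NNReal.coe_inv, NNReal.coe_sub hcN.le, NNReal.coe_inv]
  have hσr : ∀ w ∈ ball (0 : F) (((N : ℝ)⁻¹ - c) * r), σ w ∈ closedBall (0 : E) r := fun w hw =>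
    (ha w (ball_subset_closedBall hw)).1
  have hσLip : ∀ w ∈ ball (0 : F) (((N : ℝ)⁻¹ - c) * r), ∀ w' ∈ ball (0 : F) (((N : ℝ)⁻¹ - c) * r),
      ‖σ w - σ w'‖ ≤ ((N : ℝ)⁻¹ - c)⁻¹ * ‖w - w'‖ := fun w hw w' hw' => by
    have h := hlip.dist_le_mul w (ball_subset_closedBall hw) w' (ball_subset_closedBall hw')
    rw [dist_eq_norm, dist_eq_norm, hcoe] at h
    exact h
  -- (W2) the response letter at every interior background
  have hW2 : ∀ w ∈ ball (0 : F) (((N : ℝ)⁻¹ - c) * r), ∀ v, pE (fderiv ℝ σ w v) ≤ Kw * pF v := fun w hw v => by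
    obtain ⟨-, -, hQD, hPD⟩ := hb w hw
    exact seminorm_section_le Q P A (Eq' (σ w)) T hT pE pF pK hNw hTw (hcw _ (hσr w hw)) hsmall hQD hPD v
  -- (W3) the response's two-point modulus
  have hW3 : ∀ w ∈ ball (0 : F) (((N : ℝ)⁻¹ - c) * r), ∀ w' ∈ ball (0 : F) (((N : ℝ)⁻¹ - c) * r), ∀ v,
      pE ((fderiv ℝ σ w - fderiv ℝ σ w') v) ≤
        Kw * CPw * Mw * ((N : ℝ)⁻¹ - c)⁻¹ * Kw * ‖w - w'‖ * pF v := fun w hw w' hw' v => by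
    obtain ⟨-, -, hQD, hPD⟩ := hb w hw
    obtain ⟨-, -, hQD', hPD'⟩ := hb w' hw'
    have hδ : 0 ≤ Mw * (((N : ℝ)⁻¹ - c)⁻¹ * ‖w - w'‖) := mul_nonneg hMw0 (mul_nonneg hK1 (norm_nonneg _))
    have hX : ∀ u, pE ((Eq' (σ w') - Eq' (σ w)) u) ≤ Mw * (((N : ℝ)⁻¹ - c)⁻¹ * ‖w - w'‖) * pE u := fun u => by
      refine (hMw _ (hσr w' hw') _ (hσr w hw) u).trans (mul_le_mul_of_nonneg_right ?_ (apply_nonneg _ _))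
      refine mul_le_mul_of_nonneg_left ?_ hMw0
      rw [norm_sub_rev]; exact hσLip w hw w' hw'
    refine (seminorm_section_sub_le_of_modulus Q P A (Eq' (σ w)) (Eq' (σ w')) T hT pE pF pK hNw hTw (hcw _ (hσr w hw)) hsmall
      hQD hQD' hPD hPD' hCPw0 hδ hCPw hX (hW2 w' hw') v).trans_eq ?_
    simp only [hKw_def]; ring
  refine ⟨fun w hw u hQu => ?_, hW2, hW3, fun w hw v => ?_, fun w hw w' hw' v => ?_⟩
  · -- (W1) the fibre letter at the background `σ w`, `w` in the CLOSED chart ball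
    exact seminorm_fibre_le Q P A (Eq' (σ w)) T hT pE pF pK hNw hTw (hcw _ (ha w hw).1) hsmall hQu
  · -- (W4) the next derivative in the second currency
    calc pF (Q (Eq' (σ w) (fderiv ℝ σ w v))) ≤ CQw * pE (Eq' (σ w) (fderiv ℝ σ w v)) := hCQw _
      _ ≤ CQw * (Bw * (Kw * pF v)) := by
          refine mul_le_mul_of_nonneg_left ?_ hCQw0
          exact (hBw _ (hσr w hw) _).trans (mul_le_mul_of_nonneg_left (hW2 w hw v) hBw0)
      _ = CQw * Bw * Kw * pF v := by ring
  · -- (W5) the next derivative's second-currency modulus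
    have e : Q (Eq' (σ w) (fderiv ℝ σ w v)) - Q (Eq' (σ w') (fderiv ℝ σ w' v)) =
        Q ((Eq' (σ w) - Eq' (σ w')) (fderiv ℝ σ w v)) + Q (Eq' (σ w') ((fderiv ℝ σ w - fderiv ℝ σ w') v)) := by
      simp only [sub_apply, map_sub]
      abel
    have h1 : pF (Q ((Eq' (σ w) - Eq' (σ w')) (fderiv ℝ σ w v))) ≤
        CQw * (Mw * (((N : ℝ)⁻¹ - c)⁻¹ * ‖w - w'‖) * (Kw * pF v)) := by
      refine (hCQw _).trans (mul_le_mul_of_nonneg_left ?_ hCQw0)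
      refine (hMw _ (hσr w hw) _ (hσr w' hw') _).trans ?_
      refine mul_le_mul (mul_le_mul_of_nonneg_left (hσLip w hw w' hw') hMw0) (hW2 w hw v) (apply_nonneg _ _) ?_
      exact mul_nonneg hMw0 (mul_nonneg hK1 (norm_nonneg _))
    have h2 : pF (Q (Eq' (σ w') ((fderiv ℝ σ w - fderiv ℝ σ w') v))) ≤
        CQw * (Bw * (Kw * CPw * Mw * ((N : ℝ)⁻¹ - c)⁻¹ * Kw * ‖w - w'‖ * pF v)) := by
      refine (hCQw _).trans (mul_le_mul_of_nonneg_left ?_ hCQw0)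
      exact (hBw _ (hσr w' hw') _).trans (mul_le_mul_of_nonneg_left (hW3 w hw w' hw' v) hBw0)
    rw [e]
    refine (map_add_le_add pF _ _).trans ((add_le_add h1 h2).trans_eq ?_)
    ring

/-! ## §4. Toy -/

/-- Toy: the bootstrap arithmetic — `N^w = 2`, `c^w = 1∕4` give the second-currency response constant `K^w = 2∕(1 − 1∕2) = 4 ≥ N^w`. -/
example : (2 : ℝ) / (1 - 2 * (1 / 4)) = 4 := by norm_num

end Summit.QuantumFields.BalabanUV.T4Continuum.NE7b.SupResponseSecondCurrency

end
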